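import Summits.BirchSwinnertonDyer.BirchSwinnertonDyer.Theorems.CyclotomicUntwistGNineNineGoodModelLeaves
import Mathlib.NumberTheory.RamificationInertia.Basic
import Mathlib.NumberTheory.Padics.RingHoms
import Mathlib.RingTheory.DedekindDomain.IntegralClosure
import Mathlib.NumberTheory.Cyclotomic.PrimitiveRoots
import HarnessLib

/-!
# `𝓞_{ℚ₃(ζ₉)}` is TOTALLY RAMIFIED over `ℤ₃` (`e = 6`, `f = 1`), for the abstract integral closure of the 3-adic
# currency of `DescendedFrobeniusMatrix` (route `CyclotomicUntwist`, cruxes K1 / K2; companion of bridge (B2))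

Cell `pub/bsd-wall` (D-0145 line `route-BirchSwinnertonDyer-CyclotomicUntwist`), seat `bsd-line-cycu-p3` (gen 7).
Helper toward K1 `PSRankOneLowerHalfAtThree` (stmt-BirchSwinnertonDyer-21580) / K2 (21581). THEOREMS ONLY (no
definition, no named fact, no `sorry`); BSD is not proved by this file and no crux or stub is.

The Literature definition `WeierstrassCurve.IsDescendedFrobeniusMatrix` (p623342) reads special fibres along ring maps
`ρ : ONine →+* ZMod 3` (`ONine = integralClosure ℤ_[3] (CyclotomicField 9 ℚ_[3])`) and its existence fact is
quantified over such `ρ`; its docstring asserts «`𝓞_L` is local with residue field `𝔽₃`» without proof. Here: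

* `finrank_KNine_le_six` — `[ℚ₃(ζ₉) : ℚ₃] ≤ 6` (the minimal polynomial of `ζ₉` divides `Φ₉`);
* `span_varpi_pow_six` — `(ϖ)⁶ = (3)` as ideals of `ONine` (`ϖ = 1 − ζ`, `ϖ⁶ = −3θ`, `θ` a unit by
  `thetaInv_mul` — p627014);
* **`totallyRamified_ONine`** — TOTAL RAMIFICATION for the abstract integral closure, with no valuation on `L`:
  `ONine` is a Dedekind domain, finite over `ℤ₃` (Mathlib `integralClosure.isDedekindDomain`, `IsIntegralClosure.finite`);
  `(ϖ)⁶ = (3)` forces `6 ∣ e(P|3)` for every prime `P ∣ 3` (`ramificationIdx'_eq_normalizedFactors_count`), and the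
  fundamental identity `Σ e·f = [L : ℚ₃] ≤ 6` (`Ideal.sum_ramification_inertia`) forces `e(P|3) = 6`, `f(P|3) = 1` for
  every such `P` (hence `P` is unique): `ramificationIdx' = 6 ∧ inertiaDeg' = 1`;
(The existence of a reduction map `ONine →+* ZMod 3` — a corollary via `ONine ⧸ P ≃ ℤ₃ ⧸ (3) ≃ ZMod 3` — is the tree's
`NineIntegers.nonempty_residueMap`, cycu-p4 g7; not restated here.)

References: L. C. Washington, *Cyclotomic Fields*, Lemma 1.4, Prop. 2.8 [Washington1997]; J. Neukirch, *Algebraic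
Number Theory*, I.8 (fundamental identity), II.7 [NeukirchANT1999]; J.-P. Serre, *Local Fields*, I.§6–7 [SerreLocalFields].
-/

-- single-conjunct summit: `Summit.BirchSwinnertonDyer.BirchSwinnertonDyer.…` repeats the name by design
set_option linter.dupNamespace false
set_option autoImplicit false

noncomputable section

open scoped Classical

open Literature.NumberTheory.EllipticCurves.DescendedFrobenius IsDedekindDomain Ideal UniqueFactorizationMonoid
  Summit.BirchSwinnertonDyer.BirchSwinnertonDyer.Theorems.GNine

namespace Summit.BirchSwinnertonDyer.BirchSwinnertonDyer.Theorems.GNineFrobeniusTrace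

/-- **`[ℚ₃(ζ₉) : ℚ₃] ≤ 6`**: the degree of a cyclotomic extension is the degree of the minimal polynomial of `ζ`,
which divides `Φ₉` of degree `φ(9) = 6`. [cite: Washington1997, Ch. 2 (Prop. 2.8 setting)] -/
theorem finrank_KNine_le_six : Module.finrank ℚ_[3] KNine ≤ 6 := by
  have hζ := IsCyclotomicExtension.zeta_spec 9 ℚ_[3] KNine
  rw [(hζ.powerBasis ℚ_[3]).finrank, IsPrimitiveRoot.powerBasis_dim]
  have hdvd : minpoly ℚ_[3] (IsCyclotomicExtension.zeta 9 ℚ_[3] KNine) ∣ Polynomial.cyclotomic 9 ℚ_[3] := by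
    apply minpoly.dvd
    rw [Polynomial.aeval_def, Polynomial.eval₂_eq_eval_map, Polynomial.map_cyclotomic]
    exact hζ.isRoot_cyclotomic (by norm_num)
  have h := Polynomial.natDegree_le_of_dvd hdvd (Polynomial.cyclotomic_ne_zero 9 ℚ_[3])
  rw [Polynomial.natDegree_cyclotomic] at h
  have h9 : Nat.totient 9 = 6 := by decide
  omega

/-- `ϖ⁶ = −3θ` and `θ·θ′ = 1` in `ONine` (`ϖ = 1 − ζ`): so **`(ϖ)⁶ = (3)`** as ideals of `ONine`.
[cite: Washington1997, Lemma 1.4] -/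
theorem span_varpi_pow_six :
    (Ideal.span {(1 - ⟨IsCyclotomicExtension.zeta 9 ℚ_[3] KNine, zeta_mem_ONine⟩ : ONine)}) ^ 6 =
      Ideal.span {(3 : ONine)} := by
  set ζ : KNine := IsCyclotomicExtension.zeta 9 ℚ_[3] KNine with hζdef
  have hζ : IsPrimitiveRoot ζ 9 := IsCyclotomicExtension.zeta_spec 9 ℚ_[3] KNine
  set ζO : ONine := ⟨ζ, zeta_mem_ONine⟩ with hζO
  set ϖO : ONine := 1 - ζO with hϖO
  set ϖ : KNine := (1 : KNine) - ζ with hϖdef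
  have hϖK : algebraMap ONine KNine ϖO = ϖ := by rw [hϖO, map_sub, map_one]; rfl
  have h6 := varpi_pow_six hζ
  rw [← hϖdef] at h6
  set θO : ONine := (1 : ℤ) + (-3 : ℤ) * ϖO + (6 : ℤ) * ϖO ^ 2 + (-7 : ℤ) * ϖO ^ 3 + (5 : ℤ) * ϖO ^ 4
    + (-2 : ℤ) * ϖO ^ 5 with hθO
  set θ'O : ONine := (-38 : ℤ) + (51 : ℤ) * ϖO + (-21 : ℤ) * ϖO ^ 2 + (-14 : ℤ) * ϖO ^ 3 + (16 : ℤ) * ϖO ^ 4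
    + (-4 : ℤ) * ϖO ^ 5 with hθ'O
  have hθK : algebraMap ONine KNine θO = 1 - 3 * ϖ + 6 * ϖ ^ 2 - 7 * ϖ ^ 3 + 5 * ϖ ^ 4 - 2 * ϖ ^ 5 := by
    simp only [hθO, map_add, map_mul, map_pow, map_intCast, hϖK]; push_cast; ring
  have hθ'K : algebraMap ONine KNine θ'O = -38 + 51 * ϖ - 21 * ϖ ^ 2 - 14 * ϖ ^ 3 + 16 * ϖ ^ 4 - 4 * ϖ ^ 5 := by
    simp only [hθ'O, map_add, map_mul, map_pow, map_intCast, hϖK]; push_cast; ring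
  have hTO : θO * θ'O = 1 := by
    apply Subtype.ext
    show algebraMap ONine KNine (θO * θ'O) = algebraMap ONine KNine 1
    rw [map_mul, map_one, hθK, hθ'K]; exact thetaInv_mul ϖ h6
  have h6O : ϖO ^ 6 = 3 * (-θO) := by
    apply Subtype.ext
    show algebraMap ONine KNine (ϖO ^ 6) = algebraMap ONine KNine (3 * (-θO))
    rw [map_pow, hϖK, map_mul, map_neg, hθK, map_ofNat, h6]; ring
  have hu : IsUnit (-θO) := (IsUnit.of_mul_eq_one θ'O hTO).neg
  rw [Ideal.span_singleton_pow, Ideal.span_singleton_eq_span_singleton, h6O]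
  obtain ⟨u, hu'⟩ := hu
  exact ⟨u⁻¹, by rw [← hu', mul_assoc, Units.mul_inv, mul_one]⟩

/-- `3 ≠ 0` in `ONine`. [folklore] -/
theorem three_ne_zero_ONine : (3 : ONine) ≠ 0 := by
  intro h
  have := congrArg (algebraMap ONine KNine) h
  rw [map_ofNat, map_zero] at this
  exact three_ne_zero this

/-- **Total ramification of `𝓞_{ℚ₃(ζ₉)}` over `ℤ₃`, for the abstract integral closure**: every prime `P` of
`ONine = integralClosure ℤ₃ ℚ₃(ζ₉)` above the maximal ideal of `ℤ₃` has ramification index `e(P|3) = 6` and residue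
degree `f(P|3) = 1`, and `[ℚ₃(ζ₉) : ℚ₃] = 6`. Proof: `(ϖ)⁶ = (3)` gives `6 ∣ e(P)` for every `P ∣ 3` (unique factorisation
of ideals), and the fundamental identity `Σ_P e(P)f(P) = [L : ℚ₃] ≤ 6` leaves room for `e = 6, f = 1` only.
[cite: NeukirchANT1999, I.(8.2) (fundamental identity)] [cite: Washington1997, Lemma 1.4 and Prop. 2.8] -/
theorem totallyRamified_ONine (P : Ideal ONine) [P.IsPrime] [P.LiesOver (IsLocalRing.maximalIdeal ℤ_[3])] :
    ramificationIdx' (IsLocalRing.maximalIdeal ℤ_[3]) P = 6 ∧ inertiaDeg' (IsLocalRing.maximalIdeal ℤ_[3]) P = 1 ∧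
      Module.finrank ℚ_[3] KNine = 6 := by
  classical
  -- the Dedekind package for `ONine / ℤ₃`
  haveI hfd : FiniteDimensional ℚ_[3] KNine := IsCyclotomicExtension.finite {9} ℚ_[3] KNine
  haveI hDed : IsDedekindDomain ONine := integralClosure.isDedekindDomain ℤ_[3] ℚ_[3] KNine
  haveI hfin : Module.Finite ℤ_[3] ONine := IsIntegralClosure.finite ℤ_[3] ℚ_[3] KNine ONine
  haveI hfrac : IsFractionRing ONine KNine :=
    IsIntegralClosure.isFractionRing_of_finite_extension ℤ_[3] ℚ_[3] KNine ONine
  set p : Ideal ℤ_[3] := IsLocalRing.maximalIdeal ℤ_[3] with hpdef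
  haveI hpmax : p.IsMaximal := IsLocalRing.maximalIdeal.isMaximal ℤ_[3]
  have hp3 : p = Ideal.span {(3 : ℤ_[3])} := by
    rw [hpdef, PadicInt.maximalIdeal_eq_span_p]; norm_cast
  have hp0 : p ≠ ⊥ := by
    rw [hp3, Ne, Ideal.span_singleton_eq_bot]; exact_mod_cast (by norm_num : (3 : ℕ) ≠ 0)
  have hmap : Ideal.map (algebraMap ℤ_[3] ONine) p = Ideal.span {(3 : ONine)} := by
    rw [hp3, Ideal.map_span, Set.image_singleton, map_ofNat]
  have hmap0 : Ideal.map (algebraMap ℤ_[3] ONine) p ≠ ⊥ := by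
    rw [hmap, Ne, Ideal.span_singleton_eq_bot]; exact three_ne_zero_ONine
  -- the fundamental identity and the degree bound
  have hsum := Ideal.sum_ramification_inertia ONine ℚ_[3] KNine hp0
  have hle : Module.finrank ℚ_[3] KNine ≤ 6 := finrank_KNine_le_six
  have hPmem' : P ∈ p.primesOver ONine := ⟨inferInstance, inferInstance⟩
  have hP : P ∈ IsDedekindDomain.primesOverFinset p ONine :=
    (IsDedekindDomain.mem_primesOverFinset_iff hp0 ONine).mpr hPmem'
  have hP0 : P ≠ ⊥ := ne_bot_of_mem_primesOver hp0 hPmem'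
  have hPprime : P.IsPrime := inferInstance
  -- `6 ∣ e(P)` and `e(P) ≥ 6`
  set ϖO : ONine := 1 - ⟨IsCyclotomicExtension.zeta 9 ℚ_[3] KNine, zeta_mem_ONine⟩ with hϖO
  have hϖ0 : ϖO ≠ 0 := by
    intro h
    have h6 := span_varpi_pow_six
    rw [← hϖO, h, Ideal.span_singleton_pow, zero_pow (by norm_num), Ideal.span_singleton_zero] at h6
    exact hmap0 (by rw [hmap, ← h6])
  have hspan0 : Ideal.span {ϖO} ≠ ⊥ := by rwa [Ne, Ideal.span_singleton_eq_bot]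
  have hcount : ramificationIdx' p P = 6 * (normalizedFactors (Ideal.span {ϖO})).count P := by
    rw [IsDedekindDomain.ramificationIdx'_eq_normalizedFactors_count hmap0 hPprime hP0, hmap,
      ← span_varpi_pow_six, ← hϖO, normalizedFactors_pow, Multiset.count_nsmul]
  have hmem : P ∈ normalizedFactors (Ideal.span {ϖO}) := by
    rw [Ideal.mem_normalizedFactors_iff hspan0]
    refine ⟨hPprime, ?_⟩
    rw [Ideal.span_singleton_le_iff_mem]
    have h3P : (3 : ONine) ∈ P := by
      have : Ideal.map (algebraMap ℤ_[3] ONine) p ≤ P :=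
        Ideal.map_le_iff_le_comap.mpr (le_of_eq ((Ideal.liesOver_iff P p).mp inferInstance))
      exact this (by rw [hmap]; exact Ideal.mem_span_singleton_self _)
    have h6P : ϖO ^ 6 ∈ P := by
      have hin : ϖO ^ 6 ∈ Ideal.span {(3 : ONine)} := by
        rw [← span_varpi_pow_six, ← hϖO, Ideal.span_singleton_pow]; exact Ideal.mem_span_singleton_self _
      obtain ⟨c, hc⟩ := Ideal.mem_span_singleton'.mp hin
      rw [← hc]; exact P.mul_mem_left c h3P
    exact hPprime.mem_of_pow_mem 6 h6P
  have he6 : 6 ≤ ramificationIdx' p P := by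
    rw [hcount]
    have := Multiset.one_le_count_iff_mem.mpr hmem
    omega
  -- `e = 6`, `f = 1`, `n = 6`
  have hfpos : 0 < inertiaDeg' p P := inertiaDeg'_pos p P
  have hterm : ramificationIdx' p P * inertiaDeg' p P ≤ Module.finrank ℚ_[3] KNine := by
    rw [← hsum, ← Finset.add_sum_erase _ _ hP]
    exact Nat.le_add_right _ _
  refine ⟨by nlinarith, by nlinarith, by nlinarith⟩

end Summit.BirchSwinnertonDyer.BirchSwinnertonDyer.Theorems.GNineFrobeniusTrace

end
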